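import Summits.AtomisticToContinuum.Crystallization.Theorems.MinimisingLawsHaveAtoms.Negative.RandomSpacingChain
import Summits.AtomisticToContinuum.Crystallization.Theorems.PalmUnimodularRigidityBenjaminiSchrammLimitEnergy
import Summits.AtomisticToContinuum.Crystallization.Theorems.MinimisingLawsCohesive.Negative.RootedComb
import Summits.AtomisticToContinuum.Crystallization.Theorems.MinimisingLawsCohesive.Negative.OnePointMixtures

/-!
# Negative knowledge for crux `MinimisingLawsHaveAtoms` (stmt-AtomisticToContinuum-15776), IV:
# the energy of the random-spacing chain law — the normalisation `P(univ) = 1` is load-bearing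

Standing crux disprover `cdisprove-stmt-AtomisticToContinuum-15776`,
`--supports stmt-AtomisticToContinuum-15776`; continues `RandomSpacingChain.lean` (definition-free).

* `integral_lennardJones_zmultiples_le` — the root energy of a chain `ℤ · s e₀` (`1 ≤ s`) is at most
  its nearest-neighbour term: `∫ V_LJ(‖y‖) d(count|ℤ s e₀) ≤ V_LJ(s)` (Bochner, genuine: the landed
  `integrable_lennardJones_toMeasure`; every other term is `≤ 0`).
* `integral_rootEnergy_chainLaw_le` — for `t ∈ [0,1]` the spacing `1 + eᵗ/3` lies in `[1, 2]`, so
  `E₁ := E_{chainLaw}[h] ≤ V_LJ(2)/2 = −127/98304 < 0` (`RootedComb.lennardJones_le_of_mem_Icc`;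
  continuity of the energy along the family from the landed
  `continuous_integral_lennardJones_toMeasure`).
* `minimisingLawsHaveAtoms_false_without_probability` — with `IsProbabilityMeasure P` weakened to
  "`P` finite and non-zero" (everything else verbatim) the crux is FALSE: the finite measure
  `(e*/E₁) • chainLaw` is non-zero, a.s. `1`-hard-core, point-stationary, has `∫ h = e*` EXACTLY
  and charges no rooted isometry class.  The energy hypothesis is not scale-invariant in `P`: the
  honest frame for finite measures is `∫ h dP ≤ e* · P(univ)`; together with Part I (minimising ⇔
  `= e*`) this says the crux lives exactly on the affine slice `{P(univ) = 1, E_P[h] = e*}` of the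
  cone of point-stationary hard-core measures.
All `[folklore]`.
-/

noncomputable section

namespace Summit.AtomisticToContinuum.Crystallization.Theorems.MinimisingLawsHaveAtoms.Negative.RandomSpacingChainEnergy

open MeasureTheory Set Filter Metric Function
open scoped ENNReal Topology
open Literature.MathematicalPhysics.StatisticalMechanics Literature.Probability.Process
open Literature.Probability.Process.LocalConfig
open Summit.AtomisticToContinuum.Crystallization.Theorems.ChargedEnergyGapNegative (eStar eStar_le)
open Summit.AtomisticToContinuum.Crystallization.Theorems.BenjaminiSchrammLimit
  (integrable_lennardJones_toMeasure continuous_integral_lennardJones_toMeasure)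
open Summit.AtomisticToContinuum.Crystallization.Theorems.PricedLinkCensusLocalToGlobalPhaseGap
  (eStar_le_neg)
open Summit.AtomisticToContinuum.Crystallization.Theorems.MinimisingLawsCohesive.Negative.RootedComb
  (lennardJones_le_of_mem_Icc)
open Summit.AtomisticToContinuum.Crystallization.Theorems.MinimisingLawsHaveAtoms.Negative.DiffuseFamilyLaws
open Summit.AtomisticToContinuum.Crystallization.Theorems.MinimisingLawsHaveAtoms.Negative.RandomSpacingChain

/-! ## §1 The root energy of a chain -/

/-- **The root energy of a chain is at most its nearest-neighbour term**:
`∫ V_LJ(‖y‖) d(count|ℤ s e₀) ≤ V_LJ(s)` for `1 ≤ s` — every term is `≤ 0` (`‖y‖ ∈ {0} ∪ [s, ∞)`,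
`V_LJ(0) = 0`, `V_LJ ≤ 0` on `[1, ∞)`), the integral is a genuine Bochner integral (hard core).
[folklore] -/
theorem integral_lennardJones_zmultiples_le {s : ℝ} (hs : 1 ≤ s) :
    ∫ y, lennardJones ‖y‖ ∂((Measure.count : Measure (EuclideanSpace ℝ (Fin 3))).restrict
      (AddSubgroup.zmultiples (s • EuclideanSpace.single (0 : Fin 3) (1 : ℝ)) :
        Set (EuclideanSpace ℝ (Fin 3)))) ≤ lennardJones s := by
  haveI : Fact ((0 : ℝ) < 1) := ⟨one_pos⟩
  have hs0 : 0 < s := one_pos.trans_le hs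
  set S : RootedHardCoreConfig (EuclideanSpace ℝ (Fin 3)) 1 :=
    ⟨LocalConfig.mk (AddSubgroup.zmultiples (s • EuclideanSpace.single (0 : Fin 3) (1 : ℝ)) :
      Set (EuclideanSpace ℝ (Fin 3))), zmultiples_rooted_hardCore hs⟩ with hSdef
  have hint : Integrable (fun y : EuclideanSpace ℝ (Fin 3) => lennardJones ‖y‖)
      ((Measure.count : Measure (EuclideanSpace ℝ (Fin 3))).restrict
        (AddSubgroup.zmultiples (s • EuclideanSpace.single (0 : Fin 3) (1 : ℝ)) :
          Set (EuclideanSpace ℝ (Fin 3)))) :=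
    integrable_lennardJones_toMeasure one_pos S
  set w : EuclideanSpace ℝ (Fin 3) := s • EuclideanSpace.single (0 : Fin 3) (1 : ℝ) with hw
  have hVw : lennardJones ‖w‖ = lennardJones s := by
    have h1 : ‖(EuclideanSpace.single (0 : Fin 3) (1 : ℝ))‖ = 1 := by simp
    rw [hw, norm_smul, h1, mul_one, Real.norm_of_nonneg hs0.le]
  have hwmem : w ∈ (AddSubgroup.zmultiples (s • EuclideanSpace.single (0 : Fin 3) (1 : ℝ)) :
      Set (EuclideanSpace ℝ (Fin 3))) := mem_zmultiples_smul_iff.2 ⟨1, by simp [hw]⟩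
  have hle : (fun y : EuclideanSpace ℝ (Fin 3) => lennardJones ‖y‖)
      ≤ᵐ[(Measure.count : Measure (EuclideanSpace ℝ (Fin 3))).restrict
        (AddSubgroup.zmultiples (s • EuclideanSpace.single (0 : Fin 3) (1 : ℝ)) :
          Set (EuclideanSpace ℝ (Fin 3)))]
      ({w} : Set (EuclideanSpace ℝ (Fin 3))).indicator fun y => lennardJones ‖y‖ := by
    filter_upwards [ae_restrict_mem (countable_zmultiples _).measurableSet] with y hy
    by_cases hyw : y = w
    · subst hyw
      rw [indicator_of_mem (mem_singleton _)]
    · rw [indicator_of_notMem (show y ∉ ({w} : Set (EuclideanSpace ℝ (Fin 3))) from hyw)]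
      obtain ⟨k, rfl⟩ := mem_zmultiples_smul_iff.1 hy
      rw [norm_chainPt hs0.le]
      by_cases hk : k = 0
      · subst hk
        simp [lennardJones_zero]
      · refine lennardJones_nonpos ?_
        have h1 : (1 : ℝ) ≤ |(k : ℝ)| := by
          rw [← Int.cast_abs]; exact_mod_cast Int.one_le_abs hk
        nlinarith [abs_nonneg (k : ℝ)]
  calc ∫ y, lennardJones ‖y‖ ∂((Measure.count : Measure (EuclideanSpace ℝ (Fin 3))).restrict
        (AddSubgroup.zmultiples (s • EuclideanSpace.single (0 : Fin 3) (1 : ℝ)) :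
          Set (EuclideanSpace ℝ (Fin 3))))
      ≤ ∫ y, ({w} : Set (EuclideanSpace ℝ (Fin 3))).indicator (fun y => lennardJones ‖y‖) y
          ∂((Measure.count : Measure (EuclideanSpace ℝ (Fin 3))).restrict
            (AddSubgroup.zmultiples (s • EuclideanSpace.single (0 : Fin 3) (1 : ℝ)) :
              Set (EuclideanSpace ℝ (Fin 3)))) :=
        integral_mono_ae hint (hint.indicator (measurableSet_singleton w)) hle
    _ = lennardJones s := by
        rw [integral_indicator (measurableSet_singleton w),
          Measure.restrict_restrict (measurableSet_singleton w),
          Set.inter_eq_self_of_subset_left (Set.singleton_subset_iff.2 hwmem),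
          Measure.restrict_singleton, Measure.count_singleton, one_smul, integral_dirac, hVw]

/-- On `[0, 1]` the spacing `1 + eᵗ/3` lies in `[1, 2]`. [folklore] -/
theorem spacing_le_two {t : ℝ} (ht : t ∈ Icc (0 : ℝ) 1) : 1 + Real.exp t / 3 ≤ 2 := by
  have h1 : Real.exp t ≤ Real.exp 1 := Real.exp_le_exp.2 ht.2
  have h2 : Real.exp 1 ≤ 3 := by
    have := Real.exp_one_lt_d9
    linarith
  linarith

/-- **On `[0, 1]` the root energy of the chain is `≤ −127/98304 < 0`.** [folklore] -/
theorem rootEnergy_chain_le {t : ℝ} (ht : t ∈ Icc (0 : ℝ) 1) :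
    rootEnergy lennardJones ((Measure.count : Measure (EuclideanSpace ℝ (Fin 3))).restrict
      (AddSubgroup.zmultiples ((1 + Real.exp t / 3) • EuclideanSpace.single (0 : Fin 3) (1 : ℝ)) :
        Set (EuclideanSpace ℝ (Fin 3)))) ≤ -127 / 98304 := by
  rw [rootEnergy_def]
  have h1 := integral_lennardJones_zmultiples_le (one_lt_spacing t).le
  have h2 := lennardJones_le_of_mem_Icc (one_lt_spacing t).le (spacing_le_two ht)
  linarith

/-- The root energy is continuous along the chain family (landed continuity of the local energy
functional on the configuration space, composed with the continuous family). [folklore] -/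
theorem continuous_rootEnergy_chain :
    Continuous fun t : ℝ => rootEnergy lennardJones
      ((Measure.count : Measure (EuclideanSpace ℝ (Fin 3))).restrict
        (AddSubgroup.zmultiples ((1 + Real.exp t / 3) • EuclideanSpace.single (0 : Fin 3) (1 : ℝ)) :
          Set (EuclideanSpace ℝ (Fin 3)))) := by
  haveI : Fact ((0 : ℝ) < 1) := ⟨one_pos⟩
  set f : ℝ → RootedHardCoreConfig (EuclideanSpace ℝ (Fin 3)) 1 := fun t =>
    ⟨LocalConfig.mk (AddSubgroup.zmultiples
      ((1 + Real.exp t / 3) • EuclideanSpace.single (0 : Fin 3) (1 : ℝ)) :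
        Set (EuclideanSpace ℝ (Fin 3))), zmultiples_rooted_hardCore (one_lt_spacing t).le⟩ with hf
  have hcont : Continuous f :=
    (continuous_mk_zmultiples (σ := fun t => 1 + Real.exp t / 3)
      (continuous_const.add (Real.continuous_exp.div_const 3))
      fun t => (one_lt_spacing t).le).subtype_mk _
  simp only [rootEnergy_def]
  exact ((continuous_integral_lennardJones_toMeasure one_pos).comp hcont).div_const 2

/-- **Mean root energy of the chain law**: `E₁ ≤ −127/98304`. [folklore] -/
theorem integral_rootEnergy_chainLaw_le :
    (∫ μ, rootEnergy lennardJones μ ∂(((volume : Measure ℝ).restrict (Icc 0 1)).map fun t : ℝ =>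
      (Measure.count : Measure (EuclideanSpace ℝ (Fin 3))).restrict
        (AddSubgroup.zmultiples ((1 + Real.exp t / 3) • EuclideanSpace.single (0 : Fin 3) (1 : ℝ)) :
          Set (EuclideanSpace ℝ (Fin 3))))) ≤ -127 / 98304 := by
  haveI := isProbabilityMeasure_volume_Icc
  rw [integral_map_family measurableEmbedding_chain]
  have hint : Integrable (fun t : ℝ => rootEnergy lennardJones
      ((Measure.count : Measure (EuclideanSpace ℝ (Fin 3))).restrict
        (AddSubgroup.zmultiples ((1 + Real.exp t / 3) • EuclideanSpace.single (0 : Fin 3) (1 : ℝ)) :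
          Set (EuclideanSpace ℝ (Fin 3)))))
      ((volume : Measure ℝ).restrict (Icc 0 1)) :=
    continuous_rootEnergy_chain.integrableOn_Icc
  have hle : (fun t : ℝ => rootEnergy lennardJones
      ((Measure.count : Measure (EuclideanSpace ℝ (Fin 3))).restrict
        (AddSubgroup.zmultiples ((1 + Real.exp t / 3) • EuclideanSpace.single (0 : Fin 3) (1 : ℝ)) :
          Set (EuclideanSpace ℝ (Fin 3)))))
      ≤ᵐ[(volume : Measure ℝ).restrict (Icc 0 1)] fun _ => (-127 / 98304 : ℝ) := by
    filter_upwards [ae_restrict_mem measurableSet_Icc] with t ht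
    exact rootEnergy_chain_le ht
  calc _ ≤ ∫ _t, (-127 / 98304 : ℝ) ∂((volume : Measure ℝ).restrict (Icc 0 1)) :=
        integral_mono_ae hint (integrable_const _) hle
    _ = -127 / 98304 := by rw [integral_const, probReal_univ, one_smul]

/-- `E₁ < 0`. [folklore] -/
theorem integral_rootEnergy_chainLaw_neg :
    (∫ μ, rootEnergy lennardJones μ ∂(((volume : Measure ℝ).restrict (Icc 0 1)).map fun t : ℝ =>
      (Measure.count : Measure (EuclideanSpace ℝ (Fin 3))).restrict
        (AddSubgroup.zmultiples ((1 + Real.exp t / 3) • EuclideanSpace.single (0 : Fin 3) (1 : ℝ)) :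
          Set (EuclideanSpace ℝ (Fin 3))))) < 0 := by
  linarith [integral_rootEnergy_chainLaw_le]

/-! ## §2 The normalisation `P(univ) = 1` is load-bearing -/

/-- **The normalisation is load-bearing**: with `IsProbabilityMeasure P` weakened to "`P` finite and
non-zero" (everything else verbatim) the crux is FALSE — the rescaled chain measure
`(e*/E₁) • chainLaw` is finite, non-zero, a.s. `1`-hard-core, point-stationary, has `∫ h = e*`
exactly and charges no rooted isometry class. [folklore] -/
theorem minimisingLawsHaveAtoms_false_without_probability :
    ¬ (∀ δ : ℝ, 0 < δ → ∀ P : Measure (Measure (EuclideanSpace ℝ (Fin 3))), IsFiniteMeasure P →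
      P ≠ 0 → (∀ᵐ μ ∂P, IsRootedHardCore δ μ) → IsPointStationaryLaw P →
      (∫ μ, rootEnergy lennardJones μ ∂P) ≤
        (⨅ Q : PeriodicConfiguration 3, Q.energyPerParticle lennardJones) →
      ∃ Y : Set (EuclideanSpace ℝ (Fin 3)), 0 < P {μ | ∃ A : EuclideanSpace ℝ (Fin 3) →ₗᵢ[ℝ]
        EuclideanSpace ℝ (Fin 3), ∃ q ∈ Y, μ = (Measure.count : Measure
          (EuclideanSpace ℝ (Fin 3))).restrict ((fun s => A (s - q)) '' Y)}) := by
  intro H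
  haveI := isProbabilityMeasure_chainLaw
  -- the chain law and its (negative) mean root energy
  set P₁ : Measure (Measure (EuclideanSpace ℝ (Fin 3))) :=
    ((volume : Measure ℝ).restrict (Icc 0 1)).map fun t : ℝ =>
      (Measure.count : Measure (EuclideanSpace ℝ (Fin 3))).restrict
        (AddSubgroup.zmultiples ((1 + Real.exp t / 3) • EuclideanSpace.single (0 : Fin 3) (1 : ℝ)) :
          Set (EuclideanSpace ℝ (Fin 3))) with hP₁
  set E₁ : ℝ := ∫ μ, rootEnergy lennardJones μ ∂P₁ with hE₁
  have hE₁neg : E₁ < 0 := integral_rootEnergy_chainLaw_neg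
  have hscale : 0 < eStar / E₁ := div_pos_of_neg_of_neg (by linarith [eStar_le_neg]) hE₁neg
  set c : ℝ≥0∞ := ENNReal.ofReal (eStar / E₁) with hc
  -- the rescaled measure
  have hfin : IsFiniteMeasure (c • P₁) :=
    ⟨by
      rw [Measure.smul_apply, smul_eq_mul]
      exact ENNReal.mul_lt_top ENNReal.ofReal_lt_top (measure_lt_top _ _)⟩
  have hne : c • P₁ ≠ 0 := by
    intro h
    have := congrArg (fun P : Measure (Measure (EuclideanSpace ℝ (Fin 3))) => P univ) h
    simp only [Measure.smul_apply, measure_univ, smul_eq_mul, mul_one, Measure.coe_zero,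
      Pi.zero_apply, hc, ENNReal.ofReal_eq_zero, not_le.2 hscale] at this
  have hhc : ∀ᵐ μ ∂(c • P₁), IsRootedHardCore 1 μ :=
    Measure.ae_smul_measure ae_isRootedHardCore_chainLaw _
  have hst : IsPointStationaryLaw (c • P₁) := isPointStationaryLaw_chainLaw.smul _
  have hE : (∫ μ, rootEnergy lennardJones μ ∂(c • P₁)) ≤
      ⨅ Q : PeriodicConfiguration 3, Q.energyPerParticle lennardJones := by
    rw [integral_smul_measure, hc, ENNReal.toReal_ofReal hscale.le, smul_eq_mul, ← hE₁,
      div_mul_cancel₀ _ hE₁neg.ne]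
    exact le_rfl
  obtain ⟨Y, hY⟩ := H 1 one_pos (c • P₁) hfin hne hhc hst hE
  refine hY.ne' ?_
  simp only [Measure.smul_apply, smul_eq_mul]
  rw [hP₁, chainLaw_rootedClass_eq_zero Y, mul_zero]

end Summit.AtomisticToContinuum.Crystallization.Theorems.MinimisingLawsHaveAtoms.Negative.RandomSpacingChainEnergy

end
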